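import Literature.AlgebraicGeometry.Frobenioids.PerfectionDivisorial
import Literature.AlgebraicGeometry.Frobenioids.RlfHomEquivariant
import Literature.AnabelianGeometry.EtaleTheta.RSupportedMonoids
import HarnessLib

/-!
# Frobenioids I, Def. 2.4 (ii), `Λ = ℝ`: "if `Λ` supports `M`, then `Λ_{>0}` acts naturally on `M`"

Mochizuki, *The geometry of Frobenioids I*, Kyushu J. Math. **62** (2008), §2, Definition 2.4 (ii) p. 48:
"we shall say that `Λ` supports `M ∈ Ob(Mon)` if any of the following conditions hold: (a) `Λ = ℤ`; (b) `Λ = ℚ`,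
and `M` is perfect; (c) `Λ = ℝ`, `M` is perfect and perf-factorial, and for every `𝔭 ∈ Prime(M)`, the monoid
`M_𝔭` is `ℝ`-monoprime.  Note that if `Λ` supports `M`, then `Λ_{>0}` acts naturally on `M`."
[cite: MochizukiFrdI2008, Def. 2.4(ii) p.48]

The tree constructs this action for `Λ = ℤ` (`natPosAction`) and `Λ = ℚ` (`IsPerfect.ratPosAct`) and notes
"the case `Λ = ℝ` (via the realification) is not constructed here" (`PerfFactorial.lean`).  It is
constructed here: if `ℝ` supports `M` then the natural map `M = M^pf → M^rlf` is an ISOMORPHISM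
(`Supports.toRealification_bijective`: injective by Def. 2.4 (i)(c); surjective by (d), since every
`M^pf_𝔮 ≅ M_𝔭` is `ℝ`-monoprime so that `M^pf_𝔮 → M^pf_𝔮 ⊗ ℝ_{≥0}` is onto — `RSupportedMonoids.lean`,
`RealificationCoordinates.lean`, seat abc-iut-L2-d2), and the powers `a ↦ a^r` of `M^rlf`
(`RealificationRPow.lean`) transport to `M` (`Supports.realPow`, `Supports.realPosAction`).  "Naturally":
every homomorphism between monoids supported by `ℝ` commutes with the action (`Supports.map_realPow`,
from `Rlf.map_rpow`).  Seat abc-iut-L1-d2 (cell abc-iut), row «FrdI:Def2.4(ii)-ℝ-action + I3-MERGE»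
(L1-lead R45 (4)).
-/

noncomputable section

namespace Literature.AlgebraicGeometry.Frobenioids

open Function Literature.AnabelianGeometry.EtaleTheta

universe u

variable {M : Type u} [CommMonoid M]

/-! ### `M^pf → M^rlf` is onto when the `M^pf_𝔮` are `ℝ`-monoprime -/

/-- If every `M^pf_𝔮` is `ℝ`-monoprime (so that `M^pf_𝔮 → M^rlf_𝔮 = M^pf_𝔮 ⊗ ℝ_{≥0}` is onto), the
factorization homomorphism `M^pf → M^rlf` of a perf-factorial `M` is surjective: an element of `M^rlf` lies
in `M^pf_factor` and has support inside some `Supp(b)`, `b ∈ M^pf`, hence comes from `M^pf` by condition (d)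
of Def. 2.4 (i). [cite: MochizukiFrdI2008, Def. 2.4(i) p.48] -/
theorem IsPerfFactorial.toRealification_surjective_of_isRMonoprime (h : IsPerfFactorial M)
    (hR : ∀ 𝔮 : Primes (Perfection M), IsRMonoprime (PfAt M 𝔮)) : Surjective h.toRealification := by
  intro a
  have hx : ∀ 𝔮, ∃ x : PfAt M 𝔮, Realification.of _ x = (a : RlfFactor M) 𝔮 :=
    fun 𝔮 => (RealificationCoord.of_bijective_of_isRMonoprime (hR 𝔮)).2 _
  choose x hx using hx
  have ha : pfFactorToRlfFactor M x = (a : RlfFactor M) := funext fun 𝔮 => by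
    rw [pfFactorToRlfFactor_apply, hx]
  obtain ⟨b, hb⟩ := a.2
  obtain ⟨c, hc⟩ := h.mem_range_of_supp_subset x b (by rw [ha]; exact hb)
  exact ⟨c, Subtype.ext (by rw [← ha, ← hc]; rfl)⟩

namespace Supports

/-! ### `ℝ` supports `M` ⇒ `M ≅ M^pf ≅ M^rlf` -/

/-- If `ℝ` supports `M`, `M` is perf-factorial (field (c) of Def. 2.4 (ii)). [cite: MochizukiFrdI2008, Def. 2.4(ii) p.48] -/
theorem isPerfFactorial (hS : Supports M .R) : IsPerfFactorial M := hS.2.1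

/-- If `ℝ` supports `M`, the factorization homomorphism `M^pf → M^rlf` is bijective.
[cite: MochizukiFrdI2008, Def. 2.4(ii) p.48] -/
theorem toRealification_bijective (hS : Supports M .R) : Bijective hS.isPerfFactorial.toRealification :=
  ⟨fun _ _ hab => hS.isPerfFactorial.factorMap_injective (congrArg Subtype.val hab),
    hS.isPerfFactorial.toRealification_surjective_of_isRMonoprime (RSupported.isRMonoprime_pfAt hS)⟩

/-- **`M ≅ M^rlf` when `ℝ` supports `M`**: the composite of `M ≅ M^pf` (`M` perfect) and `M^pf ≅ M^rlf`.
[cite: MochizukiFrdI2008, Def. 2.4(ii) p.48] -/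
def rlfEquiv (hS : Supports M .R) : M ≃* hS.isPerfFactorial.Rlf :=
  (IsPerfect.equivPerfection hS.1).trans
    (MulEquiv.ofBijective hS.isPerfFactorial.toRealification hS.toRealification_bijective)

/-- `rlfEquiv` is the natural map `M → M^pf → M^rlf`. [cite: MochizukiFrdI2008, Def. 2.4(ii) p.48] -/
@[simp] theorem rlfEquiv_apply (hS : Supports M .R) (a : M) :
    hS.rlfEquiv a = hS.isPerfFactorial.toRealification (Perfection.of M a) := rfl

/-! ### The action of `ℝ_{>0}` (indeed of `ℝ_{≥0}`) on `M` -/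

/-- **The power `a ↦ a^r` on `M`, `r ∈ ℝ_{≥0}`, when `ℝ` supports `M`** — "`Λ_{>0}` acts naturally on `M`",
`Λ = ℝ` (Def. 2.4 (ii) p. 48): the powers of `M^rlf` transported along `M ≅ M^rlf` (for `r = 0` this is the
constant map `1`, a harmless extension of the printed `ℝ_{>0}`-action). [cite: MochizukiFrdI2008, Def. 2.4(ii) p.48] -/
def realPow (hS : Supports M .R) (r : NNReal) : M →* M :=
  (hS.rlfEquiv.symm.toMonoidHom.comp (IsPerfFactorial.Rlf.rpow hS.isPerfFactorial r)).comp
    hS.rlfEquiv.toMonoidHom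

/-- `realPow` under `M ≅ M^rlf`: `e(a^r) = e(a)^r`. [cite: MochizukiFrdI2008, Def. 2.4(ii) p.48] -/
theorem rlfEquiv_realPow (hS : Supports M .R) (r : NNReal) (a : M) :
    hS.rlfEquiv (hS.realPow r a) = IsPerfFactorial.Rlf.rpow hS.isPerfFactorial r (hS.rlfEquiv a) := by
  rw [realPow, MonoidHom.comp_apply, MonoidHom.comp_apply, MulEquiv.coe_toMonoidHom,
    MulEquiv.coe_toMonoidHom, MulEquiv.apply_symm_apply]

/-- `a^0 = 1`. [cite: MochizukiFrdI2008, Def. 2.4(ii) p.48] -/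
@[simp] theorem realPow_zero (hS : Supports M .R) (a : M) : hS.realPow 0 a = 1 :=
  hS.rlfEquiv.injective (by rw [rlfEquiv_realPow, IsPerfFactorial.Rlf.rpow_zero, map_one])

/-- `a^1 = a`. [cite: MochizukiFrdI2008, Def. 2.4(ii) p.48] -/
@[simp] theorem realPow_one (hS : Supports M .R) (a : M) : hS.realPow 1 a = a :=
  hS.rlfEquiv.injective (by rw [rlfEquiv_realPow, IsPerfFactorial.Rlf.rpow_one])

/-- `a^{r+s} = a^r a^s`. [cite: MochizukiFrdI2008, Def. 2.4(ii) p.48] -/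
theorem realPow_add (hS : Supports M .R) (r s : NNReal) (a : M) :
    hS.realPow (r + s) a = hS.realPow r a * hS.realPow s a :=
  hS.rlfEquiv.injective (by
    rw [rlfEquiv_realPow, map_mul, rlfEquiv_realPow, rlfEquiv_realPow, IsPerfFactorial.Rlf.rpow_add])

/-- `a^{rs} = (a^s)^r`. [cite: MochizukiFrdI2008, Def. 2.4(ii) p.48] -/
theorem realPow_mul (hS : Supports M .R) (r s : NNReal) (a : M) :
    hS.realPow (r * s) a = hS.realPow r (hS.realPow s a) :=
  hS.rlfEquiv.injective (by
    rw [rlfEquiv_realPow, rlfEquiv_realPow, rlfEquiv_realPow, IsPerfFactorial.Rlf.rpow_mul])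

/-- `a^n`, `n ∈ ℕ`, is the `n`-th power (so the action extends `natPosAction`).
[cite: MochizukiFrdI2008, Def. 2.4(ii) p.48] -/
theorem realPow_natCast (hS : Supports M .R) (n : ℕ) (a : M) : hS.realPow (n : NNReal) a = a ^ n :=
  hS.rlfEquiv.injective (by rw [rlfEquiv_realPow, IsPerfFactorial.Rlf.rpow_natCast, map_pow])

/-- For `r ≠ 0`, `a ↦ a^r` is injective (indeed bijective, inverse `a ↦ a^{1/r}`).
[cite: MochizukiFrdI2008, Def. 2.4(ii) p.48] -/
theorem realPow_injective (hS : Supports M .R) {r : NNReal} (hr : r ≠ 0) : Injective (hS.realPow r) := by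
  intro a b hab
  have h1 := congrArg hS.rlfEquiv hab
  rw [rlfEquiv_realPow, rlfEquiv_realPow] at h1
  exact hS.rlfEquiv.injective (IsPerfFactorial.Rlf.rpow_injective _ hr h1)

/-- For `r ≠ 0`, `a ↦ a^r` is surjective. [cite: MochizukiFrdI2008, Def. 2.4(ii) p.48] -/
theorem realPow_surjective (hS : Supports M .R) {r : NNReal} (hr : r ≠ 0) : Surjective (hS.realPow r) := by
  intro b
  refine ⟨hS.realPow r⁻¹ b, ?_⟩
  rw [← realPow_mul, mul_inv_cancel₀ hr, realPow_one]

/-- **"`Λ_{>0}` acts naturally on `M`", `Λ = ℝ`**: the action as a monoid homomorphism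
`(ℝ_{≥0}, ·) → End(M)`, `r ↦ (a ↦ a^r)` — multiplicative in `r` (`a^{rs} = (a^s)^r`), unital; restrict to
`ℝ_{>0}` for the printed statement (`0 ↦ (a ↦ 1)`).  Compare `natPosAction` (`Λ = ℤ`).
[cite: MochizukiFrdI2008, Def. 2.4(ii) p.48] -/
def realPosAction (hS : Supports M .R) : NNReal →* Monoid.End M where
  toFun r := hS.realPow r
  map_one' := MonoidHom.ext fun a => hS.realPow_one a
  map_mul' r s := MonoidHom.ext fun a => hS.realPow_mul r s a

/-- `realPosAction r = realPow r`. [cite: MochizukiFrdI2008, Def. 2.4(ii) p.48] -/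
@[simp] theorem realPosAction_apply (hS : Supports M .R) (r : NNReal) (a : M) :
    hS.realPosAction r a = hS.realPow r a := rfl

/-- **Naturality** ("acts naturally"): every homomorphism `φ : M → M'` between monoids supported by `ℝ`
commutes with the action, `φ(a^r) = φ(a)^r` — transport of the automatic equivariance of homomorphisms of
realifications (`Rlf.map_rpow`). [cite: MochizukiFrdI2008, Def. 2.4(ii) p.48] -/
theorem map_realPow (hS : Supports M .R) {M' : Type u} [CommMonoid M'] (hS' : Supports M' .R)
    (φ : M →* M') (r : NNReal) (a : M) : φ (hS.realPow r a) = hS'.realPow r (φ a) := by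
  let ψ : hS.isPerfFactorial.Rlf →* hS'.isPerfFactorial.Rlf :=
    (hS'.rlfEquiv.toMonoidHom.comp φ).comp hS.rlfEquiv.symm.toMonoidHom
  have hψ : ∀ x, ψ (hS.rlfEquiv x) = hS'.rlfEquiv (φ x) := fun x => by
    simp only [ψ, MonoidHom.comp_apply, MulEquiv.coe_toMonoidHom, MulEquiv.symm_apply_apply]
  apply hS'.rlfEquiv.injective
  have h1 : hS'.rlfEquiv (φ (hS.realPow r a)) = ψ (hS.rlfEquiv (hS.realPow r a)) := (hψ _).symm
  rw [h1, rlfEquiv_realPow, rlfEquiv_realPow, IsPerfFactorial.Rlf.map_rpow, hψ]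

end Supports

end Literature.AlgebraicGeometry.Frobenioids
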